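import Summits.CriticalPhenomena.PercolationContinuityZ3.Theorems.PercNearOneGluingNoHeavyConstsTwoSourceBHK
import Mathlib.Combinatorics.SetFamily.FourFunctions
import HarnessLib

/-!
# Conditional association of the cluster of a RANDOM source set with a log-supermodular law
# (the Ahlswede–Daykin step over sources; PAPER-2 track (ii), seat `prim-consts-2`, gen 15)

builds on p205010 (kernel theorem, internal audit signed; external expert review pending).  Support file
(`--supports stmt-CriticalPhenomena-4575`); memo `run/shared/lean/prim/consts/FROM-prim-consts-2-g15-TWO-SOURCE.md` §0(1).
Theorems only; no sorries; standard axioms.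

The source four-functions inequality `Consts.twoSource_sameTarget` (companion file `…ConstsTwoSourceBHK.lean`) is exactly the
HYPOTHESIS of the Ahlswede–Daykin four functions theorem for the family `S ↦ ∫_{S↮T} F(C_S) dμ` on the Boolean lattice of source
sets.  This file draws the consequence that makes it usable in van den Berg–Kahn-type inductions which peel an AVOIDED vertex set
(whose open star then becomes a RANDOM source set, with a product — hence log-supermodular — law, of the remaining cluster):

* `Consts.randomSource_fourFunctions` — **THEOREM.**  Let `p : Set V → ℝ≥0` be log-supermodular (`p(S)p(S') ≤ p(S∩S')p(S∪S')`), let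
  `T ⊆ V`, and let `F_S, G_S ≥ 0` be functionals of edge sets, increasing in the edge set AND in the source set `S`.  Then
  `(Σ_S p(S) ∫_{S↮T} F_S(C_S)) · (Σ_S p(S) ∫_{S↮T} G_S(C_S)) ≤ (Σ_S p(S) μ(S↮T)) · (Σ_S p(S) ∫_{S↮T} F_S(C_S) G_S(C_S))`,
  i.e. for a random source set `𝔖 ~ p` independent of the configuration, increasing source-monotone functionals of `C_𝔖` are
  positively correlated given `{𝔖 ↮ T}` — BHK's Theorem 1.3 for a random, positively dependent source.  (With `F_S(C) = F(E_S ∪ C)`,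
  `E_S` the star edges, this is the shape of the block step after peeling a vertex set whose open star is `𝔖`.)
Proof: Mathlib's `four_functions_theorem_univ` on the lattice `Set V` with `f₁ = p·∫F`, `f₂ = p·∫G`, `f₃ = p·μ(·↮T)` (meet),
`f₄ = p·∫FG` (join); the pointwise hypothesis is `Consts.twoSource_sameTarget` for the fixed functionals `F_a, G_b`, followed by the
source monotonicity `F_a ≤ F_{a∪b}`, `G_b ≤ G_{a∪b}` and the log-supermodularity of `p`.
[cite: VandenbergHaggstromKahn2005, Thm. 1.1 (pp. 3–5), Thm. 1.3 (p. 6)] [cite: AhlswedeDaykin1978, Theorem 1] — corollary, derived here.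
-/

noncomputable section

namespace Summit.CriticalPhenomena.PercolationContinuityZ3.Theorems

open MeasureTheory Set Literature.Probability.LatticeModels Literature.Probability.Percolation
open scoped Classical

namespace Consts

variable {V : Type*} [Fintype V]

/-- **Conditional association for a random log-supermodular source set** (the Ahlswede–Daykin step over sources):
for `p ≥ 0` log-supermodular on `Set V`, a repelled set `T`, and nonnegative functionals `F_S, G_S` of edge sets that are increasing
in the edge set and in `S`,
`(Σ_S p(S)∫_{S↮T}F_S(C_S))(Σ_S p(S)∫_{S↮T}G_S(C_S)) ≤ (Σ_S p(S)μ(S↮T))(Σ_S p(S)∫_{S↮T}F_S G_S(C_S))`.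
[cite: VandenbergHaggstromKahn2005, Thm. 1.3 (p. 6)] [cite: AhlswedeDaykin1978, Theorem 1] — corollary, derived here -/
theorem randomSource_fourFunctions (w : Sym2 V → unitInterval) (T : Set V) (p : Set V → ℝ)
    (hp0 : ∀ S, 0 ≤ p S) (hp : ∀ S S', p S * p S' ≤ p (S ∩ S') * p (S ∪ S'))
    (F G : Set V → Set (Sym2 V) → ℝ)
    (hF : ∀ S, Monotone (F S)) (hG : ∀ S, Monotone (G S))
    (hFS : ∀ C, Monotone fun S => F S C) (hGS : ∀ C, Monotone fun S => G S C)
    (hF0 : ∀ S C, 0 ≤ F S C) (hG0 : ∀ S C, 0 ≤ G S C) :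
    (∑ S : Set V, p S * ∫ ω in {ω : BondConfig V | ∀ s ∈ S, ∀ x ∈ T, ¬ (openGraph ω).Reachable s x},
        F S (⋃ s ∈ S, openEdgeCluster ω s) ∂(prodBernoulli w)) *
      (∑ S : Set V, p S * ∫ ω in {ω : BondConfig V | ∀ s ∈ S, ∀ x ∈ T, ¬ (openGraph ω).Reachable s x},
        G S (⋃ s ∈ S, openEdgeCluster ω s) ∂(prodBernoulli w)) ≤
    (∑ S : Set V, p S * (prodBernoulli w).real
        {ω : BondConfig V | ∀ s ∈ S, ∀ x ∈ T, ¬ (openGraph ω).Reachable s x}) *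
      (∑ S : Set V, p S * ∫ ω in {ω : BondConfig V | ∀ s ∈ S, ∀ x ∈ T, ¬ (openGraph ω).Reachable s x},
        F S (⋃ s ∈ S, openEdgeCluster ω s) * G S (⋃ s ∈ S, openEdgeCluster ω s) ∂(prodBernoulli w)) := by
  classical
  set μ := prodBernoulli w with hμ
  -- shorthand for the four families
  set D : Set V → Set (BondConfig V) := fun S => {ω | ∀ s ∈ S, ∀ x ∈ T, ¬ (openGraph ω).Reachable s x} with hD
  set IF : Set V → ℝ := fun S => ∫ ω in D S, F S (⋃ s ∈ S, openEdgeCluster ω s) ∂μ with hIF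
  set IG : Set V → ℝ := fun S => ∫ ω in D S, G S (⋃ s ∈ S, openEdgeCluster ω s) ∂μ with hIG
  set IFG : Set V → ℝ := fun S =>
    ∫ ω in D S, F S (⋃ s ∈ S, openEdgeCluster ω s) * G S (⋃ s ∈ S, openEdgeCluster ω s) ∂μ with hIFG
  set R : Set V → ℝ := fun S => μ.real (D S) with hR
  -- nonnegativity of the integrals
  have hIF0 : ∀ S, 0 ≤ IF S := fun S => setIntegral_nonneg MeasurableSet.of_discrete fun ω _ => hF0 S _
  have hIG0 : ∀ S, 0 ≤ IG S := fun S => setIntegral_nonneg MeasurableSet.of_discrete fun ω _ => hG0 S _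
  have hIFG0 : ∀ S, 0 ≤ IFG S := fun S =>
    setIntegral_nonneg MeasurableSet.of_discrete fun ω _ => mul_nonneg (hF0 S _) (hG0 S _)
  have hR0 : ∀ S, 0 ≤ R S := fun S => measureReal_nonneg
  -- the Ahlswede–Daykin hypothesis: two-source BHK + source monotonicity + log-supermodularity of `p`
  have hyp : ∀ a b : Set V, (p a * IF a) * (p b * IG b) ≤ (p (a ⊓ b) * R (a ⊓ b)) * (p (a ⊔ b) * IFG (a ⊔ b)) := by
    intro a b
    -- two-source BHK with fixed functionals `F a`, `G b`
    have h1 := twoSource_sameTarget w a b T (F a) (G b) (hF a) (hG b) (hF0 a) (hG0 b)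
    -- source monotonicity of the integrand on the union
    have h2 : ∫ ω in D (a ∪ b), F a (⋃ s ∈ a ∪ b, openEdgeCluster ω s) *
          G b (⋃ s ∈ a ∪ b, openEdgeCluster ω s) ∂μ ≤ IFG (a ∪ b) := by
      refine setIntegral_mono_on Integrable.of_finite.integrableOn Integrable.of_finite.integrableOn
        MeasurableSet.of_discrete fun ω _ => ?_
      exact mul_le_mul (hFS _ subset_union_left) (hGS _ subset_union_right) (hG0 _ _) (hF0 _ _)
    have h3 : IF a * IG b ≤ R (a ∩ b) * IFG (a ∪ b) := by
      calc IF a * IG b ≤ (∫ ω in D (a ∪ b), F a (⋃ s ∈ a ∪ b, openEdgeCluster ω s) *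
            G b (⋃ s ∈ a ∪ b, openEdgeCluster ω s) ∂μ) * R (a ∩ b) := h1
        _ ≤ IFG (a ∪ b) * R (a ∩ b) := mul_le_mul_of_nonneg_right h2 (hR0 _)
        _ = R (a ∩ b) * IFG (a ∪ b) := mul_comm _ _
    calc (p a * IF a) * (p b * IG b) = (p a * p b) * (IF a * IG b) := by ring
      _ ≤ (p (a ∩ b) * p (a ∪ b)) * (R (a ∩ b) * IFG (a ∪ b)) :=
          mul_le_mul (hp a b) h3 (mul_nonneg (hIF0 a) (hIG0 b))
            (mul_nonneg (hp0 _) (hp0 _))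
      _ = (p (a ⊓ b) * R (a ⊓ b)) * (p (a ⊔ b) * IFG (a ⊔ b)) := by
          simp only [inf_eq_inter, sup_eq_union]; ring
  have ad := four_functions_theorem_univ (fun S => p S * IF S) (fun S => p S * IG S)
    (fun S => p S * R S) (fun S => p S * IFG S)
    (fun S => mul_nonneg (hp0 S) (hIF0 S)) (fun S => mul_nonneg (hp0 S) (hIG0 S))
    (fun S => mul_nonneg (hp0 S) (hR0 S)) (fun S => mul_nonneg (hp0 S) (hIFG0 S)) hyp
  simpa only [hIF, hIG, hIFG, hR, hD] using ad

end Consts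

end Summit.CriticalPhenomena.PercolationContinuityZ3.Theorems

end
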